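import Summits.AtomisticToContinuum.Crystallization.Theorems.FrustratedLawDichotomyCoherentFloorHaloDial
import Summits.AtomisticToContinuum.Crystallization.Theorems.FrustratedLawDichotomyCertFloorNear

/-!
# FrustratedLawDichotomy · crux `AperiodicFrustratedLawGap` (stmt-AtomisticToContinuum-27623) — THE TRUNCATED CLASS-H FLOOR (K-file entry point, halo rows)
# (decomp-a2c hand-1 g52: `…CertFloorNear` for the class-H door `…CoherentFloorHaloDial` — same truncation tails, same dials)

`certFloorHaloNear a I y τ Rc dB dH s L_d L_N R_N L_r` = the left-hand side of `certFloorHalo_le_two_mul_rootEnergy_dial` with the three whole-window columns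
replaced by their NEAR sums (root debits `‖x‖ < L_d`, NASH sites `‖z‖ ≤ R_N` with `certCoeffNear … L_N`, remainder pairs `dist < L_r`), i.e. `certFloorNear` with the
per-site far column `farCol (dB x) + halfCol (dH x)` and the extra debit `halfEnergyCol s`.  The tails are the class-A ones (`certFloorTails`, p859400) — the
truncated columns are literally the same expressions.

* ★★ `certFloorHaloNear_sub_tails_le` — `certFloorHaloNear − certFloorTails ≤` (the exact class-H floor);
* ★★★ `haloFloor_of_near_of_nash` — THE CLASS-H K-FILE ENTRY POINT: `2c ≤ certFloorHaloNear − certFloorTails` + the hypotheses of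
  `certFloorHalo_le_two_mul_rootEnergy_dial_of_nash` ⊢ `c ≤ rootEnergy V_LJ μ`.
One plain `def`; imports TREE `…CoherentFloorHaloDial` (p859487) + `…CertFloorNear` (p859400); 0 sorry.  All `[folklore]`.
-/

noncomputable section

namespace Summit.AtomisticToContinuum.Crystallization.Theorems.FrustratedLawDichotomyCertFloorHaloNear

open MeasureTheory Metric Set RealInnerProductSpace
open scoped BigOperators
open Literature.MathematicalPhysics.StatisticalMechanics (lennardJones rootEnergy)
open Literature.Probability.Process (IsRootedHardCore)
open Summit.AtomisticToContinuum.Crystallization.Theorems.ChargedEnergyGapNegative (E3)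
open Summit.AtomisticToContinuum.Crystallization.Theorems.FrustratedLawDichotomyCoherentOn (coherentOn)
open Summit.AtomisticToContinuum.Crystallization.Theorems.FrustratedLawDichotomyCoherentFloorAlgebra
open Summit.AtomisticToContinuum.Crystallization.Theorems.FrustratedLawDichotomyCoherentFloor
open Summit.AtomisticToContinuum.Crystallization.Theorems.FrustratedLawDichotomyCoherentFloorHalo (haloWindow halfCol halfEnergyCol)
open Summit.AtomisticToContinuum.Crystallization.Theorems.FrustratedLawDichotomyCoherentFloorHaloDial
  (certFloorHalo_le_two_mul_rootEnergy_dial_of_nash)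
open Summit.AtomisticToContinuum.Crystallization.Theorems.FrustratedLawDichotomyCertFloorTails (certCoeffNear nashColumn_le_near_add_tails)
open Summit.AtomisticToContinuum.Crystallization.Theorems.FrustratedLawDichotomyCertFloorTailsRem (remColumn_le_near_add_tail)
open Summit.AtomisticToContinuum.Crystallization.Theorems.FrustratedLawDichotomyCertFloorTailsEnergy (energyDebit_le_near_add_tail)
open Summit.AtomisticToContinuum.Crystallization.Theorems.FrustratedLawDichotomyCertFloorNear (certFloorTails)

/-- ★ THE TRUNCATED CLASS-H FLOOR: near sums + dialled far/half-space columns + `halfEnergyCol s` (what a halo-cell K-file evaluates). -/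
def certFloorHaloNear (a I : Finset E3) (y : E3 → E3) (τ Rc : ℝ) (dB dH : E3 → ℝ) (s L_d L_N R_N L_r : ℝ) : ℝ :=
  ∑ x ∈ a.erase 0, phiT (‖x‖ ^ 2)
    - ∑ x ∈ (a.erase 0).filter (fun x => ‖x‖ < L_d), (τ ^ 2 * secondNeg ‖x‖ + energyRem ‖x‖ τ)
    - τ * ∑ z ∈ (a.erase 0).filter (fun z => ‖z‖ ≤ R_N), ‖psiT (‖z‖ ^ 2) • z - certCoeffNear a I y L_N z‖
    - ∑ x ∈ I, ⟪y x, ∑ x' ∈ a.erase x, ljBondForce (x - x')⟫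
    - ∑ x ∈ I, ‖y x‖ * (farCol (dB x) + halfCol (dH x))
    - 1 / 2 * ∑ x ∈ a, ∑ x' ∈ (a.erase x).filter (fun x' => dist x' x < L_r),
        ‖mulExt I y x - mulExt I y x'‖ * forceRem ‖x - x'‖ (dispB τ x + dispB τ x')
    - tailCol Rc - halfEnergyCol s

/-- ★★ **TRUNCATION OF THE CLASS-H FLOOR**: `certFloorHaloNear − certFloorTails ≤` the exact left-hand side of the dialled class-H door. [folklore] -/
theorem certFloorHaloNear_sub_tails_le (a I : Finset E3) (y : E3 → E3) {δ τ Rc s L_d L_N R_N L_r : ℝ} (dB dH : E3 → ℝ) (hδ : 0 < δ)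
    (hsep : ∀ z ∈ a, ∀ z' ∈ a, z ≠ z' → δ ≤ dist z z') (hIa : I ⊆ a) (hτ0 : 0 ≤ τ)
    (hLd : δ / 2 ≤ L_d) (hτLd : τ < L_d) (hLN : δ / 2 ≤ L_N) (hRN : δ / 2 ≤ R_N) (hI : ∀ x ∈ I, ‖x‖ + L_N ≤ R_N)
    (hLr : δ / 2 ≤ L_r) (hτLr : 2 * τ < L_r) :
    certFloorHaloNear a I y τ Rc dB dH s L_d L_N R_N L_r - certFloorTails δ τ (∑ x ∈ I, ‖y x‖) L_d L_N R_N L_r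
      ≤ ∑ x ∈ a.erase 0, (phiT (‖x‖ ^ 2) - (τ ^ 2 * secondNeg ‖x‖ + energyRem ‖x‖ τ))
        - τ * ∑ z ∈ a.erase 0, ‖psiT (‖z‖ ^ 2) • z - certCoeff a I y z‖
        - ∑ x ∈ I, ⟪y x, ∑ x' ∈ a.erase x, ljBondForce (x - x')⟫
        - ∑ x ∈ I, ‖y x‖ * (farCol (dB x) + halfCol (dH x))
        - 1 / 2 * ∑ x ∈ a, ∑ x' ∈ a.erase x, ‖mulExt I y x - mulExt I y x'‖ * forceRem ‖x - x'‖ (dispB τ x + dispB τ x')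
        - tailCol Rc - halfEnergyCol s := by
  have h1 := energyDebit_le_near_add_tail a hδ hLd hτ0 hτLd hsep
  have h2 := mul_le_mul_of_nonneg_left (nashColumn_le_near_add_tails a I y hδ hLN hRN hsep hIa hI) hτ0
  have h3 := remColumn_le_near_add_tail a I y hδ hLr hτ0 hτLr hsep hIa
  unfold certFloorHaloNear certFloorTails
  rw [Finset.sum_sub_distrib]
  linarith

/-- ★★★ **THE CLASS-H K-FILE ENTRY POINT.**  A halo-cell inequality `2c ≤ certFloorHaloNear − certFloorTails` together with the hypotheses of the
dialled class-H door gives `c ≤ rootEnergy V_LJ μ`. [folklore] -/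
theorem haloFloor_of_near_of_nash {μ : Measure E3} {τ Rc s : ℝ} {a I : Finset E3} {n : E3} (y : E3 → E3) (dB dH : E3 → ℝ)
    {δ L_d L_N R_N L_r c : ℝ}
    (hcell : 2 * c ≤ certFloorHaloNear a I y τ Rc dB dH s L_d L_N R_N L_r - certFloorTails δ τ (∑ x ∈ I, ‖y x‖) L_d L_N R_N L_r)
    (hδ : 0 < δ) (hsep : ∀ z ∈ a, ∀ z' ∈ a, z ≠ z' → δ ≤ dist z z')
    (hLd : δ / 2 ≤ L_d) (hτLd : τ < L_d) (hLN : δ / 2 ≤ L_N) (hRN : δ / 2 ≤ R_N) (hIN : ∀ x ∈ I, ‖x‖ + L_N ≤ R_N)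
    (hLr : δ / 2 ≤ L_r) (hτLr : 2 * τ < L_r)
    (hn : ‖n‖ = 1) (hs : 1 ≤ s) (hμ : IsRootedHardCore (7 / 10) μ)
    (hNash : ∀ p : E3, μ {p} ≠ 0 → ∀ w : E3, (∀ q : E3, μ {q} ≠ 0 → q ≠ p → w ≠ q) →
      ∑' q : {q : E3 // μ {q} ≠ 0 ∧ q ≠ p}, lennardJones (dist p (q : E3)) ≤
        ∑' q : {q : E3 // μ {q} ≠ 0 ∧ q ≠ p}, lennardJones (dist w (q : E3)))
    (hτ0 : 0 ≤ τ) (hτ : 2 * τ < 7 / 10) (hRc : 1 ≤ Rc) (hcoh : μ ∈ coherentOn a τ (haloWindow n s Rc))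
    (h0a : (0 : E3) ∈ a) (hIa : I ⊆ a) (ha : ∀ x ∈ a, ∀ x' ∈ a, x ≠ x' → 2 * τ < dist x x')
    (hin : ∀ x ∈ a, ‖x‖ + τ ≤ Rc ∧ ⟪x, n⟫ + τ ≤ s)
    (hI : ∀ x ∈ I, (7 / 20 ≤ dB x ∧ dB x ≤ Rc - (‖x‖ + τ)) ∧ (7 / 20 ≤ dH x ∧ dH x ≤ s - (⟪x, n⟫ + τ))) :
    c ≤ rootEnergy lennardJones μ := by
  have h1 := certFloorHaloNear_sub_tails_le a I y (Rc := Rc) (s := s) dB dH hδ hsep hIa hτ0 hLd hτLd hLN hRN hIN hLr hτLr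
  have h2 := certFloorHalo_le_two_mul_rootEnergy_dial_of_nash y dB dH hn hs hμ hNash hτ0 hτ hRc hcoh h0a hIa ha hin hI
  linarith

end Summit.AtomisticToContinuum.Crystallization.Theorems.FrustratedLawDichotomyCertFloorHaloNear

end
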